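import Summits.NavierStokesRegularity.NavierStokesRegularity.Theorems.SoloSalvageWu2026Sobolev
import Literature.Analysis.FunctionSpaces.WeakLpQuantitative
import Mathlib.MeasureTheory.Measure.Lebesgue.EqHaar
import Mathlib.MeasureTheory.Integral.MeanInequalities
import HarnessLib

/-!
# C177 `Wu2026` — SALVAGE, TRUE column: the three tails of (3.73)–(3.74)/(3.81) and the absolute
# convergence of the physical current — first conjunct of `Step_382` (D-0090 NS-CLAIMS, LADDER
# row rung 3; salvage seat `ns-claims-salvage-p3`)

Second helper toward the binder `Literature.Claims.NS.Wu2026.Step_382` (harmonic cut-off energy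
inequality (3.72)–(3.82), p.23–25). With `v ∈ L⁶` from `SoloSalvageWu2026Sobolev`:

* `setLIntegral_enorm_rpow_le_eLpNorm_six` — Hölder on a set: `∫_S|v|^s ≤ ‖v‖₆^s |S|^{1−s/6}`;
* `lintegral_exterior_mul_rpow_neg_lt_top` — the SHELL LEMMA: ball bounds `∫_{B_r} F ≤ A r^a`
  (`r ≥ R`) with `a < b` give `∫_{|x|>R} F|x|^{−b} < ∞` (dyadic shells, geometric series `2^{a−b}`);
* the three tails `∫_{|x|>R}|v|³|x|^{−2}`, `∫_{|x|>R}|v|²|x|^{−3}`, `∫_{|x|>R}|q||v||x|^{−2} < ∞`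
  for `v ∈ L⁶`, `q ∈ L^{9/4,∞}` (`lintegral_exterior_{cube,sq,pressure}_lt_top`; the pressure tail
  uses the quantitative layer cake `MemWeakLp.setLIntegral_rpow_le` at height `r^{−4/3}`);
* `integrableOn_current` — **(3.73)–(3.74)**: for an `IsWuFlow` with `D(v) < ∞` and
  `p − c ∈ L^{9/4,∞}`, the integrand `𝒬 v·x/|x|³` (`𝒬 = (p − c) + |v|²/2`) of the physical current
  (3.82) is integrable on `{|x| > R}`, `R > 0` — literally the first conjunct of `Step_382`.

Theorems only, standard axioms.

WHAT THIS IS NOT: not a claim about NS regularity or blow-up; not a claim about any author beyond the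
typed locator.
-/

set_option linter.dupNamespace false

noncomputable section

open MeasureTheory Set Filter Topology Module Metric
open scoped ENNReal NNReal Topology RealInnerProductSpace

namespace Summit.NavierStokesRegularity.NavierStokesRegularity.Theorems.Wu2026Salvage

open Literature.Analysis.FluidPDE Literature.Analysis.FunctionSpaces Literature.Claims.NS.Wu2026

/-! ## Hölder on sets against the `L⁶` norm -/

/-- Hölder: `∫_S |v|^s ≤ ‖v‖_{L⁶}^s · |S|^{1 − s/6}` for `0 < s < 6`. [folklore] -/
theorem setLIntegral_enorm_rpow_le_eLpNorm_six {v : E3 → E3} (hv : AEStronglyMeasurable v volume)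
    {s : ℝ} (hs : 0 < s) (hs6 : s < 6) (S : Set E3) :
    ∫⁻ x in S, ‖v x‖ₑ ^ s ≤ eLpNorm v 6 volume ^ s * volume S ^ (1 - s / 6) := by
  have ha : 0 < s / 6 := by positivity
  have hb : 0 < 1 - s / 6 := by linarith
  have hpq : (s / 6)⁻¹.HolderConjugate (1 - s / 6)⁻¹ := Real.HolderConjugate.inv_inv ha hb (by ring)
  have hf : AEMeasurable (fun x => ‖v x‖ₑ ^ s) (volume.restrict S) :=
    (hv.enorm.pow_const s).restrict
  have h := ENNReal.lintegral_mul_le_Lp_mul_Lq (volume.restrict S) hpq hf aemeasurable_const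
    (g := fun _ => 1)
  simp only [Pi.mul_apply, mul_one, ENNReal.one_rpow, lintegral_const, Measure.restrict_apply_univ,
    one_mul, one_div, inv_inv] at h
  refine h.trans ?_
  gcongr ?_ * _
  -- `(∫_S |v|^{s·(6/s)})^{s/6} ≤ ‖v‖₆^s`
  have h6 : ∀ x, (‖v x‖ₑ ^ s) ^ (s / 6)⁻¹ = ‖v x‖ₑ ^ (6 : ℝ) := fun x => by
    rw [← ENNReal.rpow_mul]; congr 1; field_simp
  simp_rw [h6]
  calc (∫⁻ x in S, ‖v x‖ₑ ^ (6 : ℝ)) ^ (s / 6) ≤ (∫⁻ x, ‖v x‖ₑ ^ (6 : ℝ)) ^ (s / 6) := by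
        gcongr; exact Measure.restrict_le_self
    _ = eLpNorm v 6 volume ^ s := by
        rw [eLpNorm_eq_lintegral_rpow_enorm_toReal (by norm_num) (by norm_num), ENNReal.toReal_ofNat,
          ← ENNReal.rpow_mul]
        congr 1; field_simp

/-- The volume of a ball of `ℝ³`: `|B_r| = r³|B₁|`, `|B₁| < ∞`. [folklore] -/
theorem volume_ball_eq (r : ℝ) (hr : 0 ≤ r) :
    volume (ball (0 : E3) r) = ENNReal.ofReal (r ^ 3) * volume (ball (0 : E3) 1) := by
  rw [Measure.addHaar_ball volume (0 : E3) hr, finrank_euclideanSpace, Fintype.card_fin]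

/-! ## Dyadic shells: finiteness of weighted exterior integrals -/

/-- **Shell lemma.** If `∫_{B_r} F ≤ A r^a` for `r ≥ R > 0` with `A < ∞`, and `a < b`, `0 < b`, then
`∫_{|x|>R} F |x|^{−b} < ∞` (dyadic shells `2^kR ≤ |x| < 2^{k+1}R` and a geometric series of ratio
`2^{a−b} < 1`). [folklore] -/
theorem lintegral_exterior_mul_rpow_neg_lt_top {F : E3 → ℝ≥0∞} {R a b : ℝ} (hR : 0 < R)
    (hb : 0 < b) (hab : a < b) {A : ℝ≥0∞} (hA : A ≠ ∞)
    (hballs : ∀ r : ℝ, R ≤ r → ∫⁻ x in ball (0 : E3) r, F x ≤ A * ENNReal.ofReal (r ^ a)) :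
    ∫⁻ x in {x : E3 | R < ‖x‖}, F x * ENNReal.ofReal (‖x‖ ^ (-b)) < ∞ := by
  set S : ℕ → Set E3 := fun k => {x | 2 ^ k * R ≤ ‖x‖ ∧ ‖x‖ < 2 ^ (k + 1) * R} with hS
  have hcover : {x : E3 | R < ‖x‖} ⊆ ⋃ k, S k := by
    intro x hx
    have hx' : 1 ≤ ‖x‖ / R := by rw [le_div_iff₀ hR, one_mul]; exact le_of_lt hx
    obtain ⟨n, hn1, hn2⟩ := exists_nat_pow_near hx' one_lt_two
    refine mem_iUnion.2 ⟨n, ?_, ?_⟩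
    · rwa [le_div_iff₀ hR] at hn1
    · rwa [div_lt_iff₀ hR] at hn2
  have hSm : ∀ k, MeasurableSet (S k) := fun k =>
    (measurableSet_le measurable_const measurable_norm).inter
      (measurableSet_lt measurable_norm measurable_const)
  set q : ℝ := (2 : ℝ) ^ (a - b) with hq
  have hq0 : 0 < q := Real.rpow_pos_of_pos two_pos _
  have hq1 : q < 1 := Real.rpow_lt_one_of_one_lt_of_neg one_lt_two (by linarith)
  set C : ℝ := (2 : ℝ) ^ a * R ^ (a - b) with hC
  have hC0 : 0 ≤ C := by positivity
  -- the shell bound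
  have hshell : ∀ k : ℕ, ∫⁻ x in S k, F x * ENNReal.ofReal (‖x‖ ^ (-b)) ≤
      A * ENNReal.ofReal C * ENNReal.ofReal q ^ k := by
    intro k
    have h2k : (0 : ℝ) < 2 ^ k * R := by positivity
    have hwk : ∀ x ∈ S k, F x * ENNReal.ofReal (‖x‖ ^ (-b)) ≤
        F x * ENNReal.ofReal ((2 ^ k * R) ^ (-b)) := fun x hx =>
      mul_le_mul_right (ENNReal.ofReal_le_ofReal
        (Real.rpow_le_rpow_of_nonpos h2k hx.1 (neg_nonpos.2 hb.le))) _
    have hsub : S k ⊆ ball (0 : E3) (2 ^ (k + 1) * R) := fun x hx => by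
      rw [mem_ball, dist_zero_right]; exact hx.2
    calc ∫⁻ x in S k, F x * ENNReal.ofReal (‖x‖ ^ (-b))
        ≤ ∫⁻ x in S k, F x * ENNReal.ofReal ((2 ^ k * R) ^ (-b)) := setLIntegral_mono' (hSm k) hwk
      _ = (∫⁻ x in S k, F x) * ENNReal.ofReal ((2 ^ k * R) ^ (-b)) :=
          lintegral_mul_const' _ _ ENNReal.ofReal_ne_top
      _ ≤ (∫⁻ x in ball (0 : E3) (2 ^ (k + 1) * R), F x) * ENNReal.ofReal ((2 ^ k * R) ^ (-b)) :=
          mul_le_mul_left (lintegral_mono_set hsub) _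
      _ ≤ A * ENNReal.ofReal ((2 ^ (k + 1) * R) ^ a) * ENNReal.ofReal ((2 ^ k * R) ^ (-b)) := by
          gcongr; exact hballs _ (by
            calc R = 1 * R := (one_mul R).symm
              _ ≤ 2 ^ (k + 1) * R := by gcongr; exact one_le_pow₀ one_le_two)
      _ = A * ENNReal.ofReal C * ENNReal.ofReal q ^ k := by
          rw [mul_assoc, mul_assoc, ← ENNReal.ofReal_mul (by positivity), ← ENNReal.ofReal_pow hq0.le,
            ← ENNReal.ofReal_mul hC0]
          congr 2
          -- the real identity `(2^{k+1}R)^a (2^kR)^{-b} = 2^a R^{a-b} q^k`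
          rw [hC, hq, ← Real.rpow_mul_natCast zero_le_two,
            Real.mul_rpow (by positivity) hR.le, Real.mul_rpow (by positivity) hR.le,
            ← Real.rpow_natCast 2 (k + 1), ← Real.rpow_natCast 2 k, ← Real.rpow_mul zero_le_two,
            ← Real.rpow_mul zero_le_two]
          have h2a : (2 : ℝ) ^ ((((k + 1 : ℕ) : ℝ)) * a) * (2 : ℝ) ^ (((k : ℕ) : ℝ) * -b) =
              (2 : ℝ) ^ a * (2 : ℝ) ^ ((a - b) * k) := by
            rw [← Real.rpow_add two_pos, ← Real.rpow_add two_pos]; congr 1; push_cast; ring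
          have hRab : R ^ a * R ^ (-b) = R ^ (a - b) := by
            rw [← Real.rpow_add hR, sub_eq_add_neg]
          calc (2 : ℝ) ^ (((k + 1 : ℕ) : ℝ) * a) * R ^ a * ((2 : ℝ) ^ (((k : ℕ) : ℝ) * -b) * R ^ (-b))
              = ((2 : ℝ) ^ (((k + 1 : ℕ) : ℝ) * a) * (2 : ℝ) ^ (((k : ℕ) : ℝ) * -b)) * (R ^ a * R ^ (-b)) := by
                ring
            _ = (2 : ℝ) ^ a * R ^ (a - b) * (2 : ℝ) ^ ((a - b) * k) := by rw [h2a, hRab]; ring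
  calc ∫⁻ x in {x : E3 | R < ‖x‖}, F x * ENNReal.ofReal (‖x‖ ^ (-b))
      ≤ ∫⁻ x in ⋃ k, S k, F x * ENNReal.ofReal (‖x‖ ^ (-b)) := lintegral_mono_set hcover
    _ ≤ ∑' k, ∫⁻ x in S k, F x * ENNReal.ofReal (‖x‖ ^ (-b)) := lintegral_iUnion_le _ _
    _ ≤ ∑' k : ℕ, A * ENNReal.ofReal C * ENNReal.ofReal q ^ k := ENNReal.tsum_le_tsum hshell
    _ = A * ENNReal.ofReal C * (1 - ENNReal.ofReal q)⁻¹ := by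
        rw [ENNReal.tsum_mul_left, ENNReal.tsum_geometric]
    _ < ∞ := by
        refine ENNReal.mul_lt_top (ENNReal.mul_lt_top hA.lt_top ENNReal.ofReal_lt_top) ?_
        refine ENNReal.inv_lt_top.2 (tsub_pos_of_lt ?_)
        exact ENNReal.ofReal_lt_one.2 hq1

/-! ## The three tails of (3.73)–(3.74) and (3.81) -/

/-- `|v|³|x|^{−2}` is integrable at infinity for `v ∈ L⁶`: `∫_{B_r}|v|³ ≤ ‖v‖₆³|B₁|^{1/2} r^{3/2}`,
`3/2 < 2`. [cite: Wu2026, (3.73)–(3.74) p.24] -/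
theorem lintegral_exterior_cube_lt_top {v : E3 → E3} (hv : AEStronglyMeasurable v volume)
    (h6 : eLpNorm v 6 volume < ∞) {R : ℝ} (hR : 0 < R) :
    ∫⁻ x in {x : E3 | R < ‖x‖}, ‖v x‖ₑ ^ (3 : ℝ) * ENNReal.ofReal (‖x‖ ^ (-(2 : ℝ))) < ∞ := by
  refine lintegral_exterior_mul_rpow_neg_lt_top hR two_pos (by norm_num : (3 : ℝ) / 2 < 2)
    (A := eLpNorm v 6 volume ^ (3 : ℝ) * volume (ball (0 : E3) 1) ^ (1 - (3 : ℝ) / 6))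
    (ENNReal.mul_ne_top (ENNReal.rpow_ne_top_of_nonneg (by norm_num) h6.ne)
      (ENNReal.rpow_ne_top_of_nonneg (by norm_num) measure_ball_lt_top.ne)) fun r hr => ?_
  have hr0 : 0 ≤ r := hR.le.trans hr
  calc ∫⁻ x in ball (0 : E3) r, ‖v x‖ₑ ^ (3 : ℝ)
      ≤ eLpNorm v 6 volume ^ (3 : ℝ) * volume (ball (0 : E3) r) ^ (1 - (3 : ℝ) / 6) :=
        setLIntegral_enorm_rpow_le_eLpNorm_six hv (by norm_num) (by norm_num) _
    _ = eLpNorm v 6 volume ^ (3 : ℝ) * volume (ball (0 : E3) 1) ^ (1 - (3 : ℝ) / 6) *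
          ENNReal.ofReal (r ^ ((3 : ℝ) / 2)) := by
        rw [volume_ball_eq r hr0, ENNReal.mul_rpow_of_nonneg _ _ (by norm_num),
          ENNReal.ofReal_rpow_of_nonneg (by positivity) (by norm_num), ← Real.rpow_natCast,
          ← Real.rpow_mul hr0]
        norm_num
        ring

/-- `|v|²|x|^{−3}` is integrable at infinity for `v ∈ L⁶`: `∫_{B_r}|v|² ≤ ‖v‖₆²|B₁|^{2/3} r²`,
`2 < 3`. [cite: Wu2026, (3.81)→(3.82) p.25] -/
theorem lintegral_exterior_sq_lt_top {v : E3 → E3} (hv : AEStronglyMeasurable v volume)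
    (h6 : eLpNorm v 6 volume < ∞) {R : ℝ} (hR : 0 < R) :
    ∫⁻ x in {x : E3 | R < ‖x‖}, ‖v x‖ₑ ^ (2 : ℝ) * ENNReal.ofReal (‖x‖ ^ (-(3 : ℝ))) < ∞ := by
  refine lintegral_exterior_mul_rpow_neg_lt_top hR three_pos (by norm_num : (2 : ℝ) < 3)
    (A := eLpNorm v 6 volume ^ (2 : ℝ) * volume (ball (0 : E3) 1) ^ (1 - (2 : ℝ) / 6))
    (ENNReal.mul_ne_top (ENNReal.rpow_ne_top_of_nonneg (by norm_num) h6.ne)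
      (ENNReal.rpow_ne_top_of_nonneg (by norm_num) measure_ball_lt_top.ne)) fun r hr => ?_
  have hr0 : 0 ≤ r := hR.le.trans hr
  calc ∫⁻ x in ball (0 : E3) r, ‖v x‖ₑ ^ (2 : ℝ)
      ≤ eLpNorm v 6 volume ^ (2 : ℝ) * volume (ball (0 : E3) r) ^ (1 - (2 : ℝ) / 6) :=
        setLIntegral_enorm_rpow_le_eLpNorm_six hv (by norm_num) (by norm_num) _
    _ = eLpNorm v 6 volume ^ (2 : ℝ) * volume (ball (0 : E3) 1) ^ (1 - (2 : ℝ) / 6) *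
          ENNReal.ofReal (r ^ (2 : ℝ)) := by
        rw [volume_ball_eq r hr0, ENNReal.mul_rpow_of_nonneg _ _ (by norm_num),
          ENNReal.ofReal_rpow_of_nonneg (by positivity) (by norm_num), ← Real.rpow_natCast,
          ← Real.rpow_mul hr0]
        norm_num
        ring

/-- `|q||v||x|^{−2}` is integrable at infinity for `q ∈ L^{9/4,∞}` and `v ∈ L⁶`:
`∫_{B_r}|q||v| ≤ ‖q‖_{L²(B_r)}‖v‖_{L²(B_r)} ≤ C r^{1/6}·r = C r^{7/6}`, `7/6 < 2` (the `L²(B_r)` bound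
on `q` is the quantitative layer cake at height `r^{−4/3}`). [cite: Wu2026, (3.73)–(3.74) p.24] -/
theorem lintegral_exterior_pressure_lt_top {v : E3 → E3} (hv : AEStronglyMeasurable v volume)
    (h6 : eLpNorm v 6 volume < ∞) {q : E3 → ℝ} (hq : MemWeakLp q ((9 : ℝ≥0∞) / 4) volume)
    {R : ℝ} (hR : 0 < R) :
    ∫⁻ x in {x : E3 | R < ‖x‖}, ‖q x‖ₑ * ‖v x‖ₑ * ENNReal.ofReal (‖x‖ ^ (-(2 : ℝ))) < ∞ := by
  set W : ℝ≥0∞ := eWeakLpPow q ((9 : ℝ≥0∞) / 4) volume with hW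
  have hWt : W ≠ ∞ := hq.eWeakLpPow_lt_top.ne
  set V1 : ℝ≥0∞ := volume (ball (0 : E3) 1) with hV1
  have hV1t : V1 ≠ ∞ := measure_ball_lt_top.ne
  set A : ℝ≥0∞ := (V1 + ENNReal.ofReal 8 * W) ^ (1 / 2 : ℝ) *
    (eLpNorm v 6 volume ^ (2 : ℝ) * V1 ^ (1 - (2 : ℝ) / 6)) ^ (1 / 2 : ℝ) with hA
  have hAt : A ≠ ∞ := by
    refine ENNReal.mul_ne_top (ENNReal.rpow_ne_top_of_nonneg (by norm_num) ?_)
      (ENNReal.rpow_ne_top_of_nonneg (by norm_num) (ENNReal.mul_ne_top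
        (ENNReal.rpow_ne_top_of_nonneg (by norm_num) h6.ne)
        (ENNReal.rpow_ne_top_of_nonneg (by norm_num) hV1t)))
    exact ENNReal.add_ne_top.2 ⟨hV1t, ENNReal.mul_ne_top ENNReal.ofReal_ne_top hWt⟩
  refine lintegral_exterior_mul_rpow_neg_lt_top hR two_pos (by norm_num : (7 : ℝ) / 6 < 2) hAt
    fun r hr => ?_
  have hr : 0 < r := hR.trans_le hr
  have h94 : ((9 : ℝ≥0∞) / 4).toReal = 9 / 4 := by
    rw [ENNReal.toReal_div]; norm_num
  -- `‖q‖²_{L²(B_r)} ≤ (V1 + 8W) r^{1/3}`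
  have hq2 : ∫⁻ x in ball (0 : E3) r, ‖q x‖ₑ ^ (2 : ℝ) ≤
      (V1 + ENNReal.ofReal 8 * W) * ENNReal.ofReal (r ^ ((1 : ℝ) / 3)) := by
    have h := MemWeakLp.setLIntegral_rpow_le (p := (9 : ℝ≥0∞) / 4) hq.1 (r := 2) two_pos
      (by rw [h94]; norm_num) (ball (0 : E3) r) (lam := r ^ (-(4 : ℝ) / 3)) (Real.rpow_pos_of_pos hr _)
    rw [h94] at h
    refine h.trans (le_of_eq ?_)
    rw [volume_ball_eq r hr.le, ← hV1, ← hW]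
    have e1 : (r ^ (-(4 : ℝ) / 3)) ^ (2 : ℝ) = r ^ ((1 : ℝ) / 3) * (r ^ 3)⁻¹ := by
      rw [← Real.rpow_mul hr.le, ← Real.rpow_natCast, ← Real.rpow_neg hr.le, ← Real.rpow_add hr]
      norm_num
    have e2 : (2 : ℝ) / (9 / 4 - 2) * (r ^ (-(4 : ℝ) / 3)) ^ ((2 : ℝ) - 9 / 4) = 8 * r ^ ((1 : ℝ) / 3) := by
      rw [← Real.rpow_mul hr.le]; norm_num
    rw [e1, e2, ENNReal.ofReal_mul (by positivity), ENNReal.ofReal_mul (by norm_num),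
      ENNReal.ofReal_inv_of_pos (by positivity)]
    have h3 : ENNReal.ofReal (r ^ 3) ≠ 0 := by positivity
    calc ENNReal.ofReal (r ^ 3) * V1 * (ENNReal.ofReal (r ^ ((1 : ℝ) / 3)) * (ENNReal.ofReal (r ^ 3))⁻¹) +
          ENNReal.ofReal 8 * ENNReal.ofReal (r ^ ((1 : ℝ) / 3)) * W
        = V1 * ENNReal.ofReal (r ^ ((1 : ℝ) / 3)) * (ENNReal.ofReal (r ^ 3) * (ENNReal.ofReal (r ^ 3))⁻¹) +
          ENNReal.ofReal 8 * W * ENNReal.ofReal (r ^ ((1 : ℝ) / 3)) := by ring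
      _ = (V1 + ENNReal.ofReal 8 * W) * ENNReal.ofReal (r ^ ((1 : ℝ) / 3)) := by
          rw [ENNReal.mul_inv_cancel h3 ENNReal.ofReal_ne_top, mul_one]; ring
  -- `‖v‖²_{L²(B_r)} ≤ ‖v‖₆² V1^{2/3} r²`
  have hv2 : ∫⁻ x in ball (0 : E3) r, ‖v x‖ₑ ^ (2 : ℝ) ≤
      eLpNorm v 6 volume ^ (2 : ℝ) * V1 ^ (1 - (2 : ℝ) / 6) * ENNReal.ofReal (r ^ (2 : ℝ)) := by
    calc ∫⁻ x in ball (0 : E3) r, ‖v x‖ₑ ^ (2 : ℝ)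
        ≤ eLpNorm v 6 volume ^ (2 : ℝ) * volume (ball (0 : E3) r) ^ (1 - (2 : ℝ) / 6) :=
          setLIntegral_enorm_rpow_le_eLpNorm_six hv (by norm_num) (by norm_num) _
      _ = _ := by
          rw [volume_ball_eq r hr.le, ENNReal.mul_rpow_of_nonneg _ _ (by norm_num),
            ENNReal.ofReal_rpow_of_nonneg (by positivity) (by norm_num), ← Real.rpow_natCast,
            ← Real.rpow_mul hr.le, ← hV1]
          norm_num
          ring
  -- Cauchy–Schwarz on `B_r`
  have hpq : (2 : ℝ).HolderConjugate 2 := by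
    rw [Real.holderConjugate_iff_eq_conjExponent one_lt_two]; norm_num
  have hcs := ENNReal.lintegral_mul_le_Lp_mul_Lq (volume.restrict (ball (0 : E3) r)) hpq
    hq.1.enorm.restrict hv.enorm.restrict
  simp only [Pi.mul_apply] at hcs
  calc ∫⁻ x in ball (0 : E3) r, ‖q x‖ₑ * ‖v x‖ₑ
      ≤ (∫⁻ x in ball (0 : E3) r, ‖q x‖ₑ ^ (2 : ℝ)) ^ (1 / (2 : ℝ)) *
          (∫⁻ x in ball (0 : E3) r, ‖v x‖ₑ ^ (2 : ℝ)) ^ (1 / (2 : ℝ)) := hcs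
    _ ≤ ((V1 + ENNReal.ofReal 8 * W) * ENNReal.ofReal (r ^ ((1 : ℝ) / 3))) ^ (1 / (2 : ℝ)) *
          (eLpNorm v 6 volume ^ (2 : ℝ) * V1 ^ (1 - (2 : ℝ) / 6) * ENNReal.ofReal (r ^ (2 : ℝ))) ^
            (1 / (2 : ℝ)) := by gcongr
    _ = A * ENNReal.ofReal (r ^ ((7 : ℝ) / 6)) := by
        rw [hA, ENNReal.mul_rpow_of_nonneg _ _ (by norm_num),
          ENNReal.mul_rpow_of_nonneg _ (ENNReal.ofReal (r ^ (2 : ℝ))) (by norm_num),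
          ENNReal.ofReal_rpow_of_nonneg (by positivity) (by norm_num),
          ENNReal.ofReal_rpow_of_nonneg (by positivity) (by norm_num), ← Real.rpow_mul hr.le,
          ← Real.rpow_mul hr.le]
        have e : ENNReal.ofReal (r ^ ((1 : ℝ) / 3 * (1 / 2))) * ENNReal.ofReal (r ^ ((2 : ℝ) * (1 / 2))) =
            ENNReal.ofReal (r ^ ((7 : ℝ) / 6)) := by
          rw [← ENNReal.ofReal_mul (by positivity), ← Real.rpow_add hr]; norm_num
        calc (V1 + ENNReal.ofReal 8 * W) ^ (1 / 2 : ℝ) * ENNReal.ofReal (r ^ ((1 : ℝ) / 3 * (1 / 2))) *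
              ((eLpNorm v 6 volume ^ (2 : ℝ) * V1 ^ (1 - (2 : ℝ) / 6)) ^ (1 / 2 : ℝ) *
                ENNReal.ofReal (r ^ ((2 : ℝ) * (1 / 2))))
            = (V1 + ENNReal.ofReal 8 * W) ^ (1 / 2 : ℝ) *
              (eLpNorm v 6 volume ^ (2 : ℝ) * V1 ^ (1 - (2 : ℝ) / 6)) ^ (1 / 2 : ℝ) *
              (ENNReal.ofReal (r ^ ((1 : ℝ) / 3 * (1 / 2))) * ENNReal.ofReal (r ^ ((2 : ℝ) * (1 / 2)))) := by
                ring
          _ = _ := by rw [e]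

/-! ## (3.73)–(3.74): the physical current is absolutely convergent -/

/-- Pointwise bound for the integrand of the physical current (3.82):
`|𝒬 v·x/|x|³| ≤ (|q||v| + |v|³)|x|^{−2}`, `𝒬 = q + |v|²/2`. [cite: Wu2026, (3.73) p.24] -/
theorem abs_current_integrand_le (v : E3 → E3) (q : E3 → ℝ) {x : E3} (hx : x ≠ 0) :
    |bern v q x * ⟪v x, x⟫ / ‖x‖ ^ 3| ≤ (|q x| * ‖v x‖ + ‖v x‖ ^ 3) * ‖x‖ ^ (-(2 : ℝ)) := by
  have hx0 : 0 < ‖x‖ := norm_pos_iff.2 hx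
  rw [abs_div, abs_mul, abs_of_pos (pow_pos hx0 3), Real.rpow_neg hx0.le,
    show ‖x‖ ^ (2 : ℝ) = ‖x‖ ^ (2 : ℕ) from by rw [← Real.rpow_natCast]; norm_num, div_eq_mul_inv]
  have hin : |⟪v x, x⟫| ≤ ‖v x‖ * ‖x‖ := abs_real_inner_le_norm _ _
  have hb : |bern v q x| ≤ |q x| + ‖v x‖ ^ 2 / 2 := by
    unfold bern
    refine (abs_add_le _ _).trans (le_of_eq ?_)
    rw [abs_of_nonneg (by positivity : (0 : ℝ) ≤ ‖v x‖ ^ 2 / 2)]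
  have h3 : (‖x‖ ^ 3)⁻¹ = ‖x‖ * ((‖x‖ ^ 2)⁻¹ * (‖x‖ ^ 2)⁻¹) := by field_simp
  calc |bern v q x| * |⟪v x, x⟫| * (‖x‖ ^ 3)⁻¹
      ≤ (|q x| + ‖v x‖ ^ 2 / 2) * (‖v x‖ * ‖x‖) * (‖x‖ ^ 3)⁻¹ := by gcongr
    _ = (|q x| * ‖v x‖ + ‖v x‖ ^ 3 / 2) * (‖x‖ ^ 2)⁻¹ := by field_simp
    _ ≤ (|q x| * ‖v x‖ + ‖v x‖ ^ 3) * (‖x‖ ^ 2)⁻¹ := by gcongr; linarith [pow_nonneg (norm_nonneg (v x)) 3]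

/-- **(3.73)–(3.74)** (p.24): for an `IsWuFlow` with `D(v) < ∞` and a pressure representative
`q = p − c ∈ L^{9/4,∞}`, the physical current integrand `𝒬 v·x/|x|³` is integrable on `{|x| > R}`,
`R > 0` — the first conjunct of `Step_382`. (Sobolev `v ∈ L⁶` + the three tails.) [cite: Wu2026, (3.73)–(3.74) p.24] -/
theorem integrableOn_current {ν : ℝ} {v : E3 → E3} {p : E3 → ℝ} (hflow : IsWuFlow ν v p)
    (hD : dirichlet v < ∞) {c : ℝ} (hq : MemWeakLp (fun x => p x - c) ((9 : ℝ≥0∞) / 4) volume)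
    {R : ℝ} (hR : 0 < R) :
    IntegrableOn (fun x => bern v (fun x => p x - c) x * ⟪v x, x⟫ / ‖x‖ ^ 3)
      {x : E3 | R < ‖x‖} := by
  have hv1 : ContDiff ℝ 1 v := hflow.smooth_v.of_le (by exact_mod_cast le_top)
  have hvc : Continuous v := hv1.continuous
  have hpc : Continuous p := hflow.smooth_p.continuous
  have hvm : AEStronglyMeasurable v volume := hvc.aestronglyMeasurable
  have h6 : eLpNorm v 6 volume < ∞ := (memLp_six_of_dirichlet_lt_top hv1 hflow.decay hD).2
  set q : E3 → ℝ := fun x => p x - c with hqdef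
  have hqc : Continuous q := hpc.sub continuous_const
  -- measurability
  have hmeas : AEStronglyMeasurable (fun x => bern v q x * ⟪v x, x⟫ / ‖x‖ ^ 3)
      (volume.restrict {x : E3 | R < ‖x‖}) := by
    have hb : Continuous (bern v q) := by
      unfold bern; exact hqc.add ((hvc.norm.pow 2).div_const 2)
    exact ((hb.mul (hvc.inner continuous_id)).measurable.div
      (continuous_norm.pow 3).measurable).aestronglyMeasurable
  refine ⟨hmeas, ?_⟩
  -- finiteness
  have hT1 := lintegral_exterior_cube_lt_top hvm h6 hR
  have hT2 := lintegral_exterior_pressure_lt_top hvm h6 hq hR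
  have hmono : ∀ x ∈ {x : E3 | R < ‖x‖},
      ‖bern v q x * ⟪v x, x⟫ / ‖x‖ ^ 3‖ₑ ≤
        ‖q x‖ₑ * ‖v x‖ₑ * ENNReal.ofReal (‖x‖ ^ (-(2 : ℝ))) +
          ‖v x‖ₑ ^ (3 : ℝ) * ENNReal.ofReal (‖x‖ ^ (-(2 : ℝ))) := by
    intro x hx
    have hx0 : x ≠ 0 := by
      rintro rfl; simp at hx; exact lt_irrefl _ (hR.trans hx)
    have h := abs_current_integrand_le v q hx0
    rw [Real.enorm_eq_ofReal_abs]
    refine (ENNReal.ofReal_le_ofReal h).trans (le_of_eq ?_)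
    rw [add_mul, ENNReal.ofReal_add (by positivity) (by positivity),
      ENNReal.ofReal_mul (by positivity), ENNReal.ofReal_mul (by positivity),
      ENNReal.ofReal_mul (by positivity), ← Real.enorm_eq_ofReal_abs, ofReal_norm,
      ENNReal.ofReal_pow (norm_nonneg _), ofReal_norm,
      show (3 : ℝ) = ((3 : ℕ) : ℝ) by norm_num, ENNReal.rpow_natCast]
  unfold HasFiniteIntegral
  calc ∫⁻ x in {x : E3 | R < ‖x‖}, ‖bern v q x * ⟪v x, x⟫ / ‖x‖ ^ 3‖ₑ
      ≤ ∫⁻ x in {x : E3 | R < ‖x‖}, (‖q x‖ₑ * ‖v x‖ₑ * ENNReal.ofReal (‖x‖ ^ (-(2 : ℝ))) +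
          ‖v x‖ₑ ^ (3 : ℝ) * ENNReal.ofReal (‖x‖ ^ (-(2 : ℝ)))) :=
        setLIntegral_mono' (measurableSet_lt measurable_const measurable_norm) hmono
    _ = (∫⁻ x in {x : E3 | R < ‖x‖}, ‖q x‖ₑ * ‖v x‖ₑ * ENNReal.ofReal (‖x‖ ^ (-(2 : ℝ)))) +
          ∫⁻ x in {x : E3 | R < ‖x‖}, ‖v x‖ₑ ^ (3 : ℝ) * ENNReal.ofReal (‖x‖ ^ (-(2 : ℝ))) := by
        refine lintegral_add_left' ?_ _
        exact ((hqc.measurable.enorm.mul hvc.measurable.enorm).mul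
          ((continuous_norm.measurable.pow_const _).ennreal_ofReal)).aemeasurable
    _ < ∞ := ENNReal.add_lt_top.2 ⟨hT2, hT1⟩

end Summit.NavierStokesRegularity.NavierStokesRegularity.Theorems.Wu2026Salvage

-- WHAT THIS IS NOT: not a claim about NS regularity or blow-up; not a claim about any author beyond the typed locator.
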